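import Summits.SmoothPoincare4.SmoothPoincare4.Theorems.EntropyRungNoncompactShrinkerGapGradientFlow
import Summits.SmoothPoincare4.SmoothPoincare4.Theorems.EntropyRungNoncompactShrinkerGapCanonicalFlow
import Summits.SmoothPoincare4.SmoothPoincare4.Theorems.EntropyRungNoncompactShrinkerGapEssentialBlowup
import Summits.SmoothPoincare4.SmoothPoincare4.Theorems.EntropyRungNoncompactShrinkerGapNoncollapsing
import Literature.Geometry.Riemannian.FourShrinkerCurvatureBounded
import Literature.Geometry.Riemannian.CurvatureNormSq
import HarnessLib

/-!
# The Type I blow-up package of a complete 4-d gradient shrinker with bounded non-decaying scalar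
# curvature (crux `EntropyRung.NoncompactShrinkerGap`, stmt-SmoothPoincare4-10868, line
# `collapsed-ends-usc`, lead c15) — everything of the printed chain of `ShrinkerSplittingAtInfinity`
# (stmt-16588) BEFORE the Enders–Müller–Topping / Naber step, in one theorem

For a complete connected normalised four-dimensional gradient shrinking Ricci soliton `(M, g, f)`
(`Ric + Hess f = g/2`, `R + |∇f|² = f`, closed `g.edist`-balls compact) with `R ≤ A` and
non-decaying scalar curvature (`ε > 0`: every compact set misses a point with `R ≥ ε`) — exactly the
hypotheses of `Literature.Geometry.Riemannian.shrinkerSplittingAtInfinity_four` — the tree now proves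
(`helper_fourShrinkerTypeIBlowupPackage`):

1. [MunteanuWang2015, Thm 1.4] a frame-wise curvature bound `|Rm_g| ≤ C`
   (`FourShrinker.curvNormSq_bounded`, lead c14, + `curvatureBoundedBy_of_curvNormSqWith_le`);
2. [Naber2010, Lemma 1.1] the global gradient flow `θ` of `∇f` and the canonical ancient Ricci flow
   `G t = (1 − t) ψ_t^* g`, `ψ_t = θ(−log(1−t), ·)`, on `(−∞, 1)` with `G 0 = g`, which is
   TYPE I: `|Rm_{G t}| ≤ C/(1 − t)` (`helper_shrinkerGradientFlow`, `helper_shrinkerCanonicalFlow_of`, composed in `helper_shrinkerCanonicalFlow`, this cycle);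
3. [EndersMullerTopping2010, Def 1.2] an ESSENTIAL BLOW-UP SEQUENCE: base points `q_k → q*` on the
   compact level set `{f = A + 1}` and times `t_k = 1 − e^{−τ_k} ↗ 1` (`τ_k → ∞`) with
   `R_{G t_k}(q_k) = e^{τ_k} R_g(θ(τ_k, q_k)) ≥ ε e^{τ_k} = ε/(1 − t_k)`, so `q*` is a Type I
   singular point (`helper_shrinkerEssentialBlowupSequence`, this cycle);
4. [Perelman2002, §4] κ-noncollapsing of `g` below scale one, uniform in the base point
   (`helper_shrinkerNoncollapsing`, this cycle).

What remains for 16588 is precisely: EMT 2011 Thm 1.4 (the rescaled flows at `q*` subconverge to a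
non-flat normalised gradient shrinker — Hamilton–Cheeger–Gromov compactness and the reduced volume
based at the singular time), Naber 2010 Lemma 4.1 (the limit splits a line: `|Hess f| ≤ C`,
`|∇f|(x_k) → ∞`), and the static-cylinder step already in `ShrinkerSplittingAtInfinityProofs.lean`.

## References

* O. Munteanu, J. Wang, Compositio Math. 151 (2015), Thm. 1.4. [MunteanuWang2015]
* A. Naber, J. reine angew. Math. 645 (2010), Lemma 1.1. [Naber2010]
* J. Enders, R. Müller, P. Topping, Comm. Anal. Geom. 19 (2011), Def. 1.2, Thm. 1.4.
  [EndersMullerTopping2010]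
* G. Perelman, arXiv:math/0211159 (2002), §4. [Perelman2002]
-/

noncomputable section

set_option linter.dupNamespace false

open scoped Manifold ContDiff ENNReal NNReal Topology
open MeasureTheory Set Filter Module
open Literature.Geometry.Lorentzian Literature.Geometry.Riemannian Literature.Geometry.Manifold

namespace Summit.SmoothPoincare4.SmoothPoincare4.Theorems.NoncompactShrinkerGapNoncollapsing

/-- **The Type I blow-up package of a complete 4-d gradient shrinker with bounded, non-decaying
scalar curvature** (items 1–4 of the module docstring): under the hypotheses of
`shrinkerSplittingAtInfinity_four` there are the gradient flow `θ`, a Ricci flow `(G, cov)` on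
`(−∞, 1)` with `G 0 = g` and `G t = (1−t) ψ_t^* g` (`ψ_t = θ(−log(1−t), ·)`), a constant `C` with
`|Rm_g| ≤ C` and the Type I bound `|Rm_{G t}| ≤ C/(1−t)` (frame-wise), an essential blow-up sequence
`q_k → q*`, `f(q_k) = f(q*) = A + 1`, `τ_k → ∞`, `ε ≤ R_g(θ(τ_k, q_k))`,
`ε e^{τ_k} ≤ R_{G(1 − e^{−τ_k})}(q_k)`, and a `κ > 0` with `κ s⁴ ≤ Vol_g B(x, s)` for all `x` and
`0 < s ≤ 1`. Composition of `FourShrinker.curvNormSq_bounded` (c14), `helper_shrinkerGradientFlow`, `helper_shrinkerCanonicalFlow_of`,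
`helper_shrinkerEssentialBlowupSequence`, `helper_shrinkerNoncollapsing` (c15).
[cite: Naber2010, Lemma 1.1] [cite: EndersMullerTopping2010, Def. 1.2] [cite: MunteanuWang2015, Thm. 1.4] -/
theorem helper_fourShrinkerTypeIBlowupPackage : ∀ (M : Type) [TopologicalSpace M] [T2Space M] [SecondCountableTopology M] [ChartedSpace (EuclideanSpace ℝ (Fin 4)) M] [IsManifold (𝓡 4) ∞ M] [ConnectedSpace M] [T3Space M] [MeasurableSpace M] [BorelSpace M] (g : PseudoRiemannianMetric (𝓡 4) ∞ (EuclideanSpace ℝ (Fin 4)) (TangentSpace (𝓡 4) : M → Type _)) [g.HasLeviCivita] (f : M → ℝ) (hg : g.IsRiemannian), (∀ (x : M) (r : NNReal), IsCompact {y : M | g.edist hg x y ≤ r}) → ContMDiff (𝓡 4) 𝓘(ℝ, ℝ) ∞ f → (∀ (x : M) (X Y : TangentSpace (𝓡 4) x), g.ricci x X Y + g.hessian f x X Y = (1 / 2 : ℝ) * g.val x X Y) → (∀ x : M, g.scalarCurvature x + g.gradSq f x = f x) → ∀ A : ℝ, (∀ x : M, g.scalarCurvature x ≤ A) → ∀ ε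 : ℝ, 0 < ε → (∀ K : Set M, IsCompact K → ∃ x, x ∉ K ∧ ε ≤ g.scalarCurvature x) → ∃ (θ : ℝ × M → M) (G : ℝ → PseudoRiemannianMetric (𝓡 4) ∞ (EuclideanSpace ℝ (Fin 4)) (TangentSpace (𝓡 4) : M → Type _)) (cov : ℝ → CovariantDerivative (𝓡 4) (EuclideanSpace ℝ (Fin 4)) (TangentSpace (𝓡 4) : M → Type _)) (C : ℝ) (q : ℕ → M) (qstar : M) (τ : ℕ → ℝ) (κ : ℝ), ContMDiff (𝓘(ℝ, ℝ).prod (𝓡 4)) (𝓡 4) ∞ θ ∧ (∀ p, θ (0, p) = p) ∧ (∀ t s p, θ (t, θ (s, p)) = θ (t + s, p)) ∧ (∀ p, IsMIntegralCurve (fun t ↦ θ (t, p)) (Literature.Geometry.Riemannian.grad g f)) ∧ (∀ p t, 0 ≤ t → f (θ (t, p)) ≤ Real.exp t * f p) ∧ IsRicciFlow G cov (Set.Iio 1) ∧ (∀ t, t < 1 → (G t).IsRiemannian) ∧ (∀ t, t < 1 → ∀ (u : M) (v w : TangentSpace (𝓡 4) u), (G t).val u v w = (1 - t) * g.val (θ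 (-Real.log (1 - t), u)) (mfderiv (𝓡 4) (𝓡 4) (fun x ↦ θ (-Real.log (1 - t), x)) u v) (mfderiv (𝓡 4) (𝓡 4) (fun x ↦ θ (-Real.log (1 - t), x)) u w)) ∧ (∀ (u : M) (v w : TangentSpace (𝓡 4) u), (G 0).val u v w = g.val u v w) ∧ (∀ t, t < 1 → ∀ u : M, (G t).scalarCurvatureWith (cov t) u = (1 - t)⁻¹ * g.scalarCurvature (θ (-Real.log (1 - t), u))) ∧ CurvatureBoundedBy g g.leviCivita C ∧ (∀ t, t < 1 → CurvatureBoundedBy (G t) (cov t) (C / (1 - t))) ∧ Tendsto q atTop (𝓝 qstar) ∧ f qstar = A + 1 ∧ (∀ k, f (q k) = A + 1) ∧ (∀ k, 0 ≤ τ k) ∧ Tendsto τ atTop atTop ∧ (∀ k, ε ≤ g.scalarCurvature (θ (τ k, q k))) ∧ (∀ k, ε * Real.exp (τ k) ≤ (G (1 - Real.exp (-τ k))).scalarCurvatureWith (cov (1 - Real.exp (-τ k))) (q k)) ∧ 0 < κ ∧ ∀ (x : M) (s : ℝ), 0 < s → s ≤ 1 → ENNReal.ofReal (κ * s ^ 4)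 ≤ g.vol (g.ball x (ENNReal.ofReal s)) := by
  intro M _ _ _ _ _ _ _ _ _ g _ f hg hc hf hsol hnorm A hA ε hε hnd
  -- (2) the canonical flow
  obtain ⟨θ, hθs, hθ0, hθgrp, hθint, -, hθexp⟩ :=
    helper_shrinkerGradientFlow 4 M g f hg hc hf hsol hnorm
  obtain ⟨G, cov, hflow, hRiem, hval, hval0, -, -, hscal, htypeI⟩ :=
    helper_shrinkerCanonicalFlow_of 4 M g f hg hf hsol θ hθs hθ0 hθgrp hθint
  -- (1) Munteanu–Wang: `|Rm|² ≤ c`, hence the frame-wise bound `√c`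
  obtain ⟨c, hcurv⟩ := FourShrinker.curvNormSq_bounded g f hg hc hf hsol hnorm hA
  have hLC : g.IsLeviCivita g.leviCivita := PseudoRiemannianMetric.isLeviCivita_leviCivita_holds
  have hCB : CurvatureBoundedBy g g.leviCivita (Real.sqrt c) :=
    curvatureBoundedBy_of_curvNormSqWith_le hg hLC hcurv
  -- (3) the essential blow-up sequence
  obtain ⟨q, qstar, τ, hq, hqstar, hqlev, hτ0, hτ, hR⟩ :=
    helper_shrinkerEssentialBlowupSequence 4 M g f hg hc hf hsol hnorm A hA ε hε hnd θ hθs hθ0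
      hθgrp hθint hθexp
  -- (4) non-collapsing
  obtain ⟨κ, hκ, hvol⟩ := helper_shrinkerNoncollapsing 4 M g f hg hc hf hsol hnorm A hA
  refine ⟨θ, G, cov, Real.sqrt c, q, qstar, τ, κ, hθs, hθ0, hθgrp, hθint, hθexp, hflow, hRiem, hval,
    hval0, hscal, hCB, fun t ht ↦ htypeI _ hCB t ht, hq, hqstar, hqlev, hτ0, hτ, hR, fun k ↦ ?_, hκ,
    fun x s hs hs1 ↦ by simpa using hvol x s hs hs1⟩
  -- `R_{G t_k}(q_k) = e^{τ_k} R_g(θ(τ_k, q_k)) ≥ ε e^{τ_k}` at `t_k = 1 − e^{−τ_k}`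
  have htk : 1 - Real.exp (-τ k) < 1 := by linarith [Real.exp_pos (-τ k)]
  have h1 : 1 - (1 - Real.exp (-τ k)) = Real.exp (-τ k) := by ring
  have hlog : -Real.log (Real.exp (-τ k)) = τ k := by rw [Real.log_exp, neg_neg]
  rw [hscal _ htk (q k), h1, hlog, Real.exp_neg, inv_inv, mul_comm (Real.exp (τ k))]
  exact mul_le_mul_of_nonneg_right (hR k) (Real.exp_pos _).le

end Summit.SmoothPoincare4.SmoothPoincare4.Theorems.NoncompactShrinkerGapNoncollapsing

end
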